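import Summits.NavierStokesRegularity.NavierStokesRegularity.Theses.PeriodicPortability
import HarnessLib.Audit

/-!
# Birth skeleton (BC3) of the crux `PeriodicPortability.BlowupPeriodises`

(crux item `stmt-NavierStokesRegularity-16203`, rank 2, route
`route-NavierStokesRegularity-PeriodicPortability` (CONDITIONAL BRIDGE on printed Clay (B));
tree path `Cruxes/BlowupPeriodises/Lines/birth.lean`; registrar
`planner-skel-stmt-NavierStokesRegularity-16203-0`, 2026-08-17. The route predates the Lean birth
certificate; this file supplies BC3 retroactively. No new definitions: the four stub signatures
are written out over tree declarations only — `IsClassicalNSSolutionOn`, `IsLerayHopfOn`,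
`HasSmoothExtensionPast` (Literature `ClassicalSolution` / `LerayHopf`), the Clay vocabulary of
`NSWave0` (`IsSmoothOnHalfSpace`, `IsNavierStokesSolution`, `HasBoundedEnergy`,
`HasRapidSpatialDecay`, `NSWave0.IsDivFree`, `IsLatticePeriodic`) and Mathlib's
`HasCompactSupport`.)

THE CRUX (fixed, the route's decl, A-form since rev 6): for every `ν > 0` and every smooth
divergence-free rapidly decaying datum `u₀` on `ℝ³` from which NO Clay-(A) solution of the
unforced system issues, there is a smooth divergence-free `ℤ³`-periodic datum `ψ` from which NO
printed-(B) solution issues (no jointly smooth `(v, q)` on `ℝ³ × [0,∞)` with `v(·,t)` periodic,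
the pressure left free as Fefferman prints (10)).

THE CUT — the route's own TWO-LAYER PLAN, typed one level down ("Zeroth: BlowupPeriodises ⇐ LH ∧
ClayFailureBlowsUp; then LH ⇐ TS_c → PER"; the Galilean normalisation recorded in the route's
BARRIERS section as the design constraint of `ForcedLerayHopfNonuniquenessNarrow`). Four stubs,
two provable now and two open, composed by pure logic:

* `stub_clayFailure_blowsUp` (A; M/L, PROVABLE NOW from the tree's local theory) — failure of
  Clay (A) at `(ν, u₀)` produces an honest BLOW-UP: a classical solution `(u, p)` on
  `ℝ³ × [0, T)`, `T > 0`, from `u₀`, Leray–Hopf from `u₀`, with no smooth extension past `T`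
  (the pointwise content of `Theorems.navierStokesRegularity_of_noBlowup`, stmt-0055: Kato maximal
  time finite, classical representative, Leray continuation, Lemarié-Rieusset's singular point);
* `stub_truncation_stability` (B; XL, OPEN — "TS_c", stability of blow-up under removal of the
  far field ON `ℝ³`) — if some rapidly decaying smooth datum blows up at `ν`, then some COMPACTLY
  SUPPORTED smooth divergence-free datum blows up at `ν` (2001 TRP trichotomy Rem r:schwartz,
  alternative (ii) vs (iii); engine: finite-codimension Lyapunov–Perron landing with compactly
  supported correctors, the 2001 wall-(a) theorem W-T);
* `stub_compact_blowup_periodises` (C; XL, OPEN — "PER", the heart: the `ℝ³ → 𝕋³_L` transfer of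
  blow-up for data that embed LITERALLY into every large torus) — a compactly supported smooth
  divergence-free blow-up datum `φ` yields a smooth divergence-free `ℤ³`-periodic datum `ψ` (a
  rescaled periodisation `ψ(x) = L φ_L(L x)`, `L ≫ diam supp φ`, same `ν` by the Navier–Stokes
  scaling) from which NO global smooth solution with `v(·,t)` AND `q(·,t)` periodic issues (the
  normalised periodic class, where smooth solutions are unique);
* `stub_galilean_pressure` (D; M/L, PROVABLE NOW — Galilean absorption of the affine pressure
  part, Tao2011 Lemma 4.1 / `NSWave0` module docstring) — a printed-(B) solution (`v` periodic,
  `q` free) from `ψ` yields one with `q(·,t)` periodic as well: `∇q(t,·)` is periodic, so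
  `q = q_per + ⟪c(t), x⟫`, and `w(t,x) = v(t, x + ξ(t)) − ξ'(t)`, `ξ'' = −c`, `ξ(0) = ξ'(0) = 0`
  solves the system from the same datum with the periodic pressure `q(t, x + ξ(t)) − ⟪c(t), x⟫`.

COMPOSITION (`blowupPeriodises_assembly`, sorry-free, pure logic; its conclusion is the crux
UNFOLDED so that `BlowupPeriodises_of` is the only theorem of this file concluding the crux BY
NAME): fix `ν`, `u₀`, `¬(A)`; A gives the blow-up `(T, u, p)`; B trades it for a compactly
supported blow-up `(φ, T', u', p')`; C periodises it to `ψ` with no normalised global smooth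
periodic solution; if a printed-(B) solution `(v, q)` issued from `ψ`, D would normalise its
pressure — contradiction. The CLOSED twin `BlowupPeriodises_of_hyps : <sig A> → <sig B> →
<sig C> → <sig D> → BlowupPeriodises` (same proof, the four signatures as hypotheses, no
placeholder anywhere) is the registrar's evidence file `bc/BlowupPeriodises_birth_closed.lean`.

WHY THIS IS A DECOMPOSITION AND NOT A COSTUME. A and D are provable bookends that move the crux
from Fefferman's printed classes (free pressure; "no Clay solution") to the classes in which the
analysis lives (classical Leray–Hopf blow-up; pressure-normalised periodic solutions) — each is a
real lemma (A = the Kato/Leray/Lemarié-Rieusset continuation argument run pointwise; D = a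
change of Galilean frame with one-sided time derivatives on the closed half-space), neither is
the crux (no periodic datum is produced by A; D produces no datum at all). B and C are the two
OPEN halves and belong to different engines: B is a pure whole-space statement (no torus in it:
"blow-up does not need Schwartz tails"), C is the crux on the DENSE SUBCLASS of compactly
supported data, where the periodisation `φ ↦ Σ_{k ∈ ℤ³} φ(· + Lk)` is a finite sum embedding the
datum verbatim into `𝕋³_L` — the only class in which the periodic/whole-space comparison up to
the singular time can even be set up (2001 TRP Thm t:periodic proof sketch; Robinson 2021 §7 for
the regular direction). Neither B nor C alone gives the crux (B has no periodic conclusion; C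
needs a compactly supported blow-up, which the crux's hypothesis does not supply), and none of
A–D gives `NavierStokesRegularity` (all four are consistent with global regularity, under which
A, B, C hold vacuously-in-kind and D is a frame change): the BC3 probes
`stub → BlowupPeriodises`, `stub → NavierStokesRegularity` by `first | exact? | simpa | aesop`
FAIL for all four stubs (registrar's `bc/probe_*.lean`, quoted in `Lines/birth.md`).

Disproof used: none exists for this crux (`ledger crux ls stmt-NavierStokesRegularity-16203`: no
workfiles — no `Disproof.lean`, no lines, no ideas; 2026-08-17). Negatives index of the summit:
no stub is an instance of a refuted statement (none concerns periodisation, truncation of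
blow-up data, or the printed/errata forms of (B)).
-/

noncomputable section

open Set MeasureTheory Filter Topology Function
open scoped ENNReal NNReal ContDiff
open Literature.Analysis.FluidPDE

namespace Summit.NavierStokesRegularity.NavierStokesRegularity.Cruxes.BlowupPeriodises.Birth

set_option linter.unusedVariables false
set_option linter.dupNamespace false

local notation "ℝ³" => EuclideanSpace ℝ (Fin 3)

/-! ### The four registered stubs

Abbreviations used in the docstrings (all written OUT in the signatures):
`Clay φ` := `ContDiff ℝ ∞ φ ∧ NSWave0.IsDivFree φ` (+ `HasRapidSpatialDecay φ` /
`HasCompactSupport φ` / `IsLatticePeriodic φ` as stated);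
`BlowsUp ν φ` := `∃ T > 0, ∃ (u, p), IsClassicalNSSolutionOn (Ico 0 T) ν 0 u p ∧ u 0 = φ ∧
IsLerayHopfOn T ν 0 φ u ∧ ¬ HasSmoothExtensionPast ν 0 u T` (a classical Leray–Hopf solution from
`φ` that fails to continue smoothly past the finite time `T`);
`NoClayA ν u₀` := `¬ ∃ (u, p), IsSmoothOnHalfSpace u ∧ IsSmoothOnHalfSpace p ∧
IsNavierStokesSolution ν 0 u₀ u p ∧ HasBoundedEnergy u` (the unforced instance of Clay (C));
`PrintedB ν ψ v q` := `IsSmoothOnHalfSpace v ∧ IsSmoothOnHalfSpace q ∧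
IsNavierStokesSolution ν 0 ψ v q ∧ ∀ t ≥ 0, IsLatticePeriodic (v t)` (Fefferman (10) as printed);
`NormalisedB` := `PrintedB ∧ ∀ t ≥ 0, IsLatticePeriodic (q t)` (the CMI-errata class). -/

/-- **stub A — `stub_clayFailure_blowsUp` (M/L; PROVABLE NOW — the local theory, pointwise).**
For `ν > 0` and a smooth divergence-free rapidly decaying datum `u₀` on `ℝ³` with NO Clay-(A)
solution, the datum BLOWS UP: there are `T > 0` and a classical solution `(u, p)` of the unforced
system on `ℝ³ × [0, T)` with `u 0 = u₀`, Leray–Hopf on `[0, T)` from `u₀`, admitting no smooth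
extension past `T`. Proof route (all inputs are tree theorems, assembled exactly as in
`Theorems.navierStokesRegularity_of_noBlowup`, stmt-0055): if Kato's maximal time of `u₀` were
infinite, `clay_solution_of_hasGlobalKatoSolution_holds` would give a Clay solution; so
`T = T_max(u₀) < ∞`, the maximal Kato solution has a classical representative glued to the local
classical solution (`mild_L3_smooth_holds`, `IsClassicalNSSolutionOn.glue`), it is Leray–Hopf up
to `T` through Leray's weak solution (`weak_strong_uniqueness_holds`, `congr_ae_slices`), and a
smooth continuation past `T` would be bounded near the singular point `(T, x₀)` of
`lemarieRieusset_singular_point_of_blowup_holds` — absurd. Sources: LemarieRieusset2016 Thm 15.1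
(C), Prop 12.3; Kato1984; Leray1934; Tao2011 Cor 11.1. -/
theorem stub_clayFailure_blowsUp :
    ∀ ν : ℝ, 0 < ν → ∀ u₀ : ℝ³ → ℝ³, ContDiff ℝ (⊤ : ℕ∞) u₀ → NSWave0.IsDivFree u₀ →
      HasRapidSpatialDecay u₀ →
      (¬ ∃ (u : ℝ → ℝ³ → ℝ³) (p : ℝ → ℝ³ → ℝ), IsSmoothOnHalfSpace u ∧ IsSmoothOnHalfSpace p ∧
          IsNavierStokesSolution ν 0 u₀ u p ∧ HasBoundedEnergy u) →
      ∃ T : ℝ, 0 < T ∧ ∃ (u : ℝ → ℝ³ → ℝ³) (p : ℝ → ℝ³ → ℝ),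
        IsClassicalNSSolutionOn (Set.Ico 0 T) ν 0 u p ∧ u 0 = u₀ ∧ IsLerayHopfOn T ν 0 u₀ u ∧
          ¬ HasSmoothExtensionPast ν 0 u T := by
  sorry

/-- **stub B — `stub_truncation_stability` (XL; OPEN — "TS_c", blow-up survives cutting off the
Schwartz tail, a statement on `ℝ³` alone).** For `ν > 0`: if a classical solution `(u, p)` on
`ℝ³ × [0, T)`, Leray–Hopf from its rapidly decaying datum `u 0`, has no smooth extension past
`T`, then SOME compactly supported smooth divergence-free datum `φ` blows up at the same `ν`
(a classical Leray–Hopf solution from `φ` on some `[0, T')` with no smooth extension past `T'`).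
`φ` is free — not necessarily a truncation of `u 0`: the intended proof solenoidally truncates
`u(t₀)` far out and re-lands the truncated datum on the blow-up side with a compactly supported
finite-dimensional corrector (finite-codimension Lyapunov–Perron landing; 2001 wall-(a) theorem
W-T for Type-I profiles), or argues by robustness when the blow-up set has interior. Why it might
fail: every blow-up from Schwartz-class data could be FRAGILE with an infinite-codimension,
tail-sensitive blow-up set (TRP alternative (iii)-type wildness of `∂G`), so that all compactly
supported perturbations are global. Sources: RusinSverak2011 (minimal blow-up data),
GallagherKochPlanchon2016, Tao2011 Rem 8.1, internal 2001 TRP Rem r:schwartz / Prop p:schwartz. -/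
theorem stub_truncation_stability :
    ∀ ν : ℝ, 0 < ν → ∀ T : ℝ, 0 < T → ∀ (u : ℝ → ℝ³ → ℝ³) (p : ℝ → ℝ³ → ℝ),
      IsClassicalNSSolutionOn (Set.Ico 0 T) ν 0 u p → IsLerayHopfOn T ν 0 (u 0) u →
      HasRapidSpatialDecay (u 0) → ¬ HasSmoothExtensionPast ν 0 u T →
      ∃ φ : ℝ³ → ℝ³, ContDiff ℝ (⊤ : ℕ∞) φ ∧ NSWave0.IsDivFree φ ∧ HasCompactSupport φ ∧
        ∃ T' : ℝ, 0 < T' ∧ ∃ (u' : ℝ → ℝ³ → ℝ³) (p' : ℝ → ℝ³ → ℝ),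
          IsClassicalNSSolutionOn (Set.Ico 0 T') ν 0 u' p' ∧ u' 0 = φ ∧
            IsLerayHopfOn T' ν 0 φ u' ∧ ¬ HasSmoothExtensionPast ν 0 u' T' := by
  sorry

/-- **stub C — `stub_compact_blowup_periodises` (XL; OPEN — "PER", the heart of the crux: blow-up
of a COMPACTLY SUPPORTED datum survives periodisation).** For `ν > 0` and a compactly supported
smooth divergence-free datum `φ` on `ℝ³` that blows up (a classical Leray–Hopf solution from `φ`
on some `[0, T)` with no smooth extension past `T`), there is a smooth divergence-free
`ℤ³`-periodic datum `ψ` from which NO jointly smooth `(v, q)` on `ℝ³ × [0,∞)` with BOTH `v(·,t)`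
and `q(·,t)` periodic solves the unforced system — i.e. the normalised periodic evolution of `ψ`
is not global. Intended `ψ`: the rescaled periodisation `ψ(x) = L · Σ_{k ∈ ℤ³} φ(L(x + k))` for a
suitable (every) large period `L` (finite sum; `u ↦ L u(L² t, L x)` keeps `ν`), the periodic and
whole-space evolutions being compared up to the singular time: energy method on the difference
with `ε`-regularity control of the far field gives closeness on `[0, t₁]`, `t₁ < T` (2001 TRP
Thm t:periodic = the support item `PeriodicAmplificationTransplant`), and the missing step —
blow-up itself, not only unbounded critical amplification, transfers — is a stability property
of the singularity (landing on the blow-up side uniformly in `L`, the periodic images being an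
exponentially receding perturbation in similarity variables). Why it might fail: for every `L`
the periodic copy could fall on the global side of a fragile threshold (Tao2011 Rem 8.1: removing
the far field in general manufactures a FORCE), and "for all large `L`" may be false even when
"for some `L`" is true. Sources: Tao2011 (arXiv:1108.1165) Thm 1.20 / Rem 8.1, arXiv:2008.04725
(Robinson 2021) Thm 7.1 and §7, RusinSverak2011, GallagherIftimiePlanchon2003, internal 2001 TRP
§10 (Thm t:periodic, Q q:L2). -/
theorem stub_compact_blowup_periodises :
    ∀ ν : ℝ, 0 < ν → ∀ φ : ℝ³ → ℝ³, ContDiff ℝ (⊤ : ℕ∞) φ → NSWave0.IsDivFree φ →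
      HasCompactSupport φ →
      (∃ T : ℝ, 0 < T ∧ ∃ (u : ℝ → ℝ³ → ℝ³) (p : ℝ → ℝ³ → ℝ),
        IsClassicalNSSolutionOn (Set.Ico 0 T) ν 0 u p ∧ u 0 = φ ∧ IsLerayHopfOn T ν 0 φ u ∧
          ¬ HasSmoothExtensionPast ν 0 u T) →
      ∃ ψ : ℝ³ → ℝ³, ContDiff ℝ (⊤ : ℕ∞) ψ ∧ NSWave0.IsDivFree ψ ∧ IsLatticePeriodic ψ ∧
        ¬ ∃ (v : ℝ → ℝ³ → ℝ³) (q : ℝ → ℝ³ → ℝ), IsSmoothOnHalfSpace v ∧ IsSmoothOnHalfSpace q ∧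
            IsNavierStokesSolution ν 0 ψ v q ∧ (∀ t, 0 ≤ t → IsLatticePeriodic (v t)) ∧
              ∀ t, 0 ≤ t → IsLatticePeriodic (q t) := by
  sorry

/-- **stub D — `stub_galilean_pressure` (M/L; PROVABLE NOW — Galilean absorption of the affine
part of the pressure; the printed-(B) class versus the CMI-errata class).** If `(v, q)` is jointly
smooth on `ℝ³ × [0,∞)` and solves the unforced system from `ψ` with `v(·,t)` `ℤ³`-periodic for
`t ≥ 0` (pressure unconstrained, Fefferman (10) as printed), then some jointly smooth `(w, ϖ)`
solves the same system from the same datum with `w(·,t)` AND `ϖ(·,t)` periodic. Proof route: by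
the momentum equation `∇q(t,·)` is periodic, hence `q(t, x + eⱼ) − q(t, x) = cⱼ(t)` with `c`
smooth on `[0,∞)`; put `ξ'' = −c`, `ξ(0) = ξ'(0) = 0` and `w(t,x) = v(t, x + ξ(t)) − ξ'(t)`,
`ϖ(t,x) = q(t, x + ξ(t)) − ⟪c(t), x⟫`: a direct computation (chain rule for the one-sided time
derivative within `[0,∞)`, translation invariance of `fderiv`, `Δ`, `gradient`, `div`) gives the
system, `w 0 = v 0 = ψ`, and both fields periodic. Valid for every real `ν` and every datum. Why
it is a stub and not glue: the printed class is non-unique exactly by these boosts (Tao2011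
Prop 7 / Lemma 4.1; barrier `ForcedLerayHopfNonuniquenessNarrow` as recorded in the route
header), and the half-space `C^∞` bookkeeping is a genuine Lean lemma. Sources: Tao2011 Lemma 4.1
and Cor 11.4, FeffermanClay2006 (10) + CMI errata, `NSWave0` module docstring. -/
theorem stub_galilean_pressure :
    ∀ ν : ℝ, ∀ ψ : ℝ³ → ℝ³, ∀ (v : ℝ → ℝ³ → ℝ³) (q : ℝ → ℝ³ → ℝ),
      IsSmoothOnHalfSpace v → IsSmoothOnHalfSpace q → IsNavierStokesSolution ν 0 ψ v q →
      (∀ t, 0 ≤ t → IsLatticePeriodic (v t)) →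
      ∃ (w : ℝ → ℝ³ → ℝ³) (ϖ : ℝ → ℝ³ → ℝ), IsSmoothOnHalfSpace w ∧ IsSmoothOnHalfSpace ϖ ∧
        IsNavierStokesSolution ν 0 ψ w ϖ ∧ (∀ t, 0 ≤ t → IsLatticePeriodic (w t)) ∧
          ∀ t, 0 ≤ t → IsLatticePeriodic (ϖ t) := by
  sorry

/-! ### The assembly (sorry-free) and the skeleton theorem -/

/-- **Assembly, closed form** (pure logic; the conclusion is the crux `BlowupPeriodises`
UNFOLDED verbatim, so that `BlowupPeriodises_of` below is the only theorem of the file concluding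
the crux by name): `¬(A)` at `(ν, u₀)` ⟹ (A) a classical Leray–Hopf blow-up from `u₀` ⟹ (B) a
compactly supported blow-up datum `φ` ⟹ (C) a periodic datum `ψ` with no normalised global smooth
periodic solution ⟹ (D) no printed-(B) solution from `ψ` either. [folklore] -/
theorem blowupPeriodises_assembly
    (hA : ∀ ν : ℝ, 0 < ν → ∀ u₀ : ℝ³ → ℝ³, ContDiff ℝ (⊤ : ℕ∞) u₀ → NSWave0.IsDivFree u₀ →
      HasRapidSpatialDecay u₀ →
      (¬ ∃ (u : ℝ → ℝ³ → ℝ³) (p : ℝ → ℝ³ → ℝ), IsSmoothOnHalfSpace u ∧ IsSmoothOnHalfSpace p ∧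
          IsNavierStokesSolution ν 0 u₀ u p ∧ HasBoundedEnergy u) →
      ∃ T : ℝ, 0 < T ∧ ∃ (u : ℝ → ℝ³ → ℝ³) (p : ℝ → ℝ³ → ℝ),
        IsClassicalNSSolutionOn (Set.Ico 0 T) ν 0 u p ∧ u 0 = u₀ ∧ IsLerayHopfOn T ν 0 u₀ u ∧
          ¬ HasSmoothExtensionPast ν 0 u T)
    (hB : ∀ ν : ℝ, 0 < ν → ∀ T : ℝ, 0 < T → ∀ (u : ℝ → ℝ³ → ℝ³) (p : ℝ → ℝ³ → ℝ),
      IsClassicalNSSolutionOn (Set.Ico 0 T) ν 0 u p → IsLerayHopfOn T ν 0 (u 0) u →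
      HasRapidSpatialDecay (u 0) → ¬ HasSmoothExtensionPast ν 0 u T →
      ∃ φ : ℝ³ → ℝ³, ContDiff ℝ (⊤ : ℕ∞) φ ∧ NSWave0.IsDivFree φ ∧ HasCompactSupport φ ∧
        ∃ T' : ℝ, 0 < T' ∧ ∃ (u' : ℝ → ℝ³ → ℝ³) (p' : ℝ → ℝ³ → ℝ),
          IsClassicalNSSolutionOn (Set.Ico 0 T') ν 0 u' p' ∧ u' 0 = φ ∧
            IsLerayHopfOn T' ν 0 φ u' ∧ ¬ HasSmoothExtensionPast ν 0 u' T')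
    (hC : ∀ ν : ℝ, 0 < ν → ∀ φ : ℝ³ → ℝ³, ContDiff ℝ (⊤ : ℕ∞) φ → NSWave0.IsDivFree φ →
      HasCompactSupport φ →
      (∃ T : ℝ, 0 < T ∧ ∃ (u : ℝ → ℝ³ → ℝ³) (p : ℝ → ℝ³ → ℝ),
        IsClassicalNSSolutionOn (Set.Ico 0 T) ν 0 u p ∧ u 0 = φ ∧ IsLerayHopfOn T ν 0 φ u ∧
          ¬ HasSmoothExtensionPast ν 0 u T) →
      ∃ ψ : ℝ³ → ℝ³, ContDiff ℝ (⊤ : ℕ∞) ψ ∧ NSWave0.IsDivFree ψ ∧ IsLatticePeriodic ψ ∧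
        ¬ ∃ (v : ℝ → ℝ³ → ℝ³) (q : ℝ → ℝ³ → ℝ), IsSmoothOnHalfSpace v ∧ IsSmoothOnHalfSpace q ∧
            IsNavierStokesSolution ν 0 ψ v q ∧ (∀ t, 0 ≤ t → IsLatticePeriodic (v t)) ∧
              ∀ t, 0 ≤ t → IsLatticePeriodic (q t))
    (hD : ∀ ν : ℝ, ∀ ψ : ℝ³ → ℝ³, ∀ (v : ℝ → ℝ³ → ℝ³) (q : ℝ → ℝ³ → ℝ),
      IsSmoothOnHalfSpace v → IsSmoothOnHalfSpace q → IsNavierStokesSolution ν 0 ψ v q →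
      (∀ t, 0 ≤ t → IsLatticePeriodic (v t)) →
      ∃ (w : ℝ → ℝ³ → ℝ³) (ϖ : ℝ → ℝ³ → ℝ), IsSmoothOnHalfSpace w ∧ IsSmoothOnHalfSpace ϖ ∧
        IsNavierStokesSolution ν 0 ψ w ϖ ∧ (∀ t, 0 ≤ t → IsLatticePeriodic (w t)) ∧
          ∀ t, 0 ≤ t → IsLatticePeriodic (ϖ t)) :
    ∀ ν : ℝ, 0 < ν → ∀ u₀ : ℝ³ → ℝ³, ContDiff ℝ (⊤ : ℕ∞) u₀ → NSWave0.IsDivFree u₀ →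
      HasRapidSpatialDecay u₀ →
      (¬ ∃ (u : ℝ → ℝ³ → ℝ³) (p : ℝ → ℝ³ → ℝ), IsSmoothOnHalfSpace u ∧ IsSmoothOnHalfSpace p ∧
          IsNavierStokesSolution ν 0 u₀ u p ∧ HasBoundedEnergy u) →
      ∃ ψ : ℝ³ → ℝ³, ContDiff ℝ (⊤ : ℕ∞) ψ ∧ NSWave0.IsDivFree ψ ∧ IsLatticePeriodic ψ ∧
        ¬ ∃ (v : ℝ → ℝ³ → ℝ³) (q : ℝ → ℝ³ → ℝ), IsSmoothOnHalfSpace v ∧ IsSmoothOnHalfSpace q ∧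
            IsNavierStokesSolution ν 0 ψ v q ∧ ∀ t, 0 ≤ t → IsLatticePeriodic (v t) := by
  intro ν hν u₀ hs hd hdec hno
  -- (A) the blow-up from `u₀`
  obtain ⟨T, hT, u, p, hcl, hu0, hLH, hnext⟩ := hA ν hν u₀ hs hd hdec hno
  have hLH' : IsLerayHopfOn T ν 0 (u 0) u := by rw [hu0]; exact hLH
  have hdec' : HasRapidSpatialDecay (u 0) := by rw [hu0]; exact hdec
  -- (B) a compactly supported blow-up datum
  obtain ⟨φ, hφs, hφd, hφc, T', hT', u', p', hcl', hu'0, hLH'', hnext'⟩ :=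
    hB ν hν T hT u p hcl hLH' hdec' hnext
  -- (C) its periodisation has no normalised global smooth periodic solution
  obtain ⟨ψ, hψs, hψd, hψp, hnone⟩ :=
    hC ν hν φ hφs hφd hφc ⟨T', hT', u', p', hcl', hu'0, hLH'', hnext'⟩
  refine ⟨ψ, hψs, hψd, hψp, ?_⟩
  -- (D) hence no printed-(B) solution
  rintro ⟨v, q, hv, hq, hsol, hvper⟩
  obtain ⟨w, ϖ, hw, hϖ, hsol', hwper, hϖper⟩ := hD ν ψ v q hv hq hsol hvper
  exact hnone ⟨w, ϖ, hw, hϖ, hsol', hwper, hϖper⟩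

/-- **Birth composition (the skeleton theorem).** The crux BY NAME from the four registered
stubs, used by name, through the sorry-free assembly `blowupPeriodises_assembly`. -/
theorem BlowupPeriodises_of :
    Summit.NavierStokesRegularity.NavierStokesRegularity.Theses.PeriodicPortability.BlowupPeriodises :=
  blowupPeriodises_assembly stub_clayFailure_blowsUp stub_truncation_stability
    stub_compact_blowup_periodises stub_galilean_pressure

end Summit.NavierStokesRegularity.NavierStokesRegularity.Cruxes.BlowupPeriodises.Birth

end
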